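import Mathlib
import Summits.ValiantsHypothesis.ValiantsHypothesis.Theorems.NewtonUnitEquationsTwoProductsPlanarCellDissociatedLinear
import Summits.ValiantsHypothesis.ValiantsHypothesis.Theorems.NewtonUnitEquationsTwoProductsFormalLogLinearisationPlanarCellTransfer
import Summits.ValiantsHypothesis.ValiantsHypothesis.Theorems.NewtonUnitEquationsTwoProductsFormalLogLinearisationStubLogLinearisation
import HarnessLib

/-!
# Route NewtonUnitEquations — crux `TwoProducts` (stmt-ValiantsHypothesis-5906): the BLOCK MERGE for confined coincidences
# (part A of the Theorems port of rung R2⁺ / R2 of the registered line `Cruxes/TwoProducts/Lines/relation_ladder.lean`, val-idea-8 g2)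

Helper mode (`--supports stmt-ValiantsHypothesis-5906 --as helper`).  PORT (val-lit port pool, seat val-port-2; director-valiant
g11-R114 (b) «turnkey → desk g11 → pool hand») of the ideator's turnkey `turnkey/NewtonUnitEquationsTwoProductsPlanarCellBlockLaw.lean`
(val-idea-8 g2, sha16 358b6fb35af61235 = tree `Cruxes/TwoProducts/Lines/relation_ladder_turnkey_BlockLaw.lean`; verbatim the proofs of
the line file @7f45314d68c5), split at the author's `end BlockMerge` by the 400-line rule: THIS FILE = the definitions and the merge
lemmas (l.1–381 of the turnkey, texts VERBATIM); part B `…PlanarCellBlockLaw.lean` = `planarCell_blockLaw`, `blockSmall_of_card`,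
`planarCell_confined`.  Setting of `planarCell_dissociated_linear` (p603804): tails `u, v : Fin m → ℂ[x,y]` with letters `A j`
(`0 ∉ A j`), a weight-order CELL FAMILY `S` of log-visible points (`IsCellFamily`).  p603804 needs the letter family to be DISSOCIATED
(`Σ` injective on letter tuples); the block law relaxes this to CONFINEMENT: two letter tuples with the same sum agree OFF a position
set `J` (`Confined A J`), with the block sumset `Σ_{j∈J}(A_j ∪ {0})` in `≤ M` points (`BlockSmall A J M`).  Mechanism (this file):
merge the block into ONE position `j₀ ∈ J` (`merge`; same `m`, no reindexing); confinement makes the merged letter family `mergeA`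
dissociated (`injOn_mergeA`); `tailDiff` is unchanged (`tailDiff_merge`), weights stay valid (`validWeight_merge`), the merged tail
support has `≤ M + m s` points (`card_tailSupport_merge_le`); the `J = ∅` rung (`confinedLaw_rung_zero'`) and the closing arithmetic
(`blockLaw_arith`).
Honest framing: helper lemmas for a rung of a crux line; the line's residual (configurations not confined to few positions),
`PlanarCellBound`, the crux `TwoProducts` and `VP ≠ VNP` are OPEN and NOT claimed; no summit statement is proved here.  No instances,
no notation, no named literature facts. [folklore]
-/

noncomputable section

-- Sub = Summit single-conjunct layout: the duplicated namespace component is mandated by the tree.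
set_option linter.dupNamespace false

open scoped BigOperators
open MvPolynomial
open Summit.ValiantsHypothesis.ValiantsHypothesis.Theorems.NewtonUnitEquations.TwoProducts.FormalLogLinearisation

namespace Summit.ValiantsHypothesis.ValiantsHypothesis.Theorems.NewtonUnitEquations.TwoProducts.PlanarCell

variable {m : ℕ}

/-- Letter tuples `∏_j (A_j ∪ {0})` (the index set of `coinTuples`). [folklore] -/
def tuples (A : Fin m → Finset Expo) : Finset (Fin m → Expo) :=
  Fintype.piFinset fun j => insert (0 : Expo) (A j)

/-- The per-cell hypothesis, verbatim the `hS` of `planarCell_charged` / `planarCell_dissociated_linear`. [folklore] -/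
def IsCellFamily (u v : Fin m → MvPolynomial (Fin 2) ℂ) (R : Expo → Expo → Prop) (S : Finset Expo) : Prop :=
  ∀ l ∈ S, ∃ ξ : Fin 2 → ℝ, ValidWeight u v ξ ∧ IsStrictTop ξ (logSupport u v) l ∧
    ∀ e ∈ tailSupport u v, ∀ e' ∈ tailSupport u v, (R e e' ↔ wt ξ e ≤ wt ξ e')

/-- Coincidences are CONFINED to the positions `J`: two letter tuples with the same point agree off `J`
(`J = ∅` is the dissociation hypothesis `hdis` of `planarCell_dissociated_linear`). [folklore] -/
def Confined (A : Fin m → Finset Expo) (J : Finset (Fin m)) : Prop :=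
  ∀ a ∈ tuples A, ∀ b ∈ tuples A, ∑ j, a j = ∑ j, b j → ∀ j, j ∉ J → a j = b j

/-- The block sumset of the positions `J` lies in at most `M` points. [folklore] -/
def BlockSmall (A : Fin m → Finset Expo) (J : Finset (Fin m)) (M : ℕ) : Prop :=
  ∃ P : Finset Expo, P.card ≤ M ∧ ∀ a ∈ tuples A, (∑ j ∈ J, a j) ∈ P

section BlockMerge

/-- The MERGED family: position `j₀` carries `∏_{i∈J}(1+u_i) − 1`, the other positions of `J` carry `0`, positions off `J`
are unchanged (same number `m` of factor pairs — no reindexing). -/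
def merge (u : Fin m → MvPolynomial (Fin 2) ℂ) (J : Finset (Fin m)) (j₀ : Fin m) : Fin m → MvPolynomial (Fin 2) ℂ :=
  fun j => if j = j₀ then (∏ i ∈ J, (1 + u i)) - 1 else if j ∈ J then 0 else u j

/-- The merged family at the distinguished position `j₀`: `∏_{i∈J}(1+u_i) − 1`. [folklore] -/
theorem merge_self (u : Fin m → MvPolynomial (Fin 2) ℂ) (J : Finset (Fin m)) (j₀ : Fin m) :
    merge u J j₀ j₀ = (∏ i ∈ J, (1 + u i)) - 1 := by simp [merge]

/-- The merged family vanishes at the other positions of the block `J`. [folklore] -/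
theorem merge_of_mem (u : Fin m → MvPolynomial (Fin 2) ℂ) (J : Finset (Fin m)) (j₀ : Fin m) {j : Fin m}
    (hj : j ∈ J) (hne : j ≠ j₀) : merge u J j₀ j = 0 := by simp [merge, hne, hj]

/-- The merged family is unchanged off the block `J`. [folklore] -/
theorem merge_of_not_mem (u : Fin m → MvPolynomial (Fin 2) ℂ) (J : Finset (Fin m)) (j₀ : Fin m) {j : Fin m}
    (hj : j ∉ J) (hj₀ : j₀ ∈ J) : merge u J j₀ j = u j := by
  have : j ≠ j₀ := fun h => hj (h ▸ hj₀)
  simp [merge, this, hj]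

/-- Merging does not change the product. -/
theorem prod_one_add_merge (u : Fin m → MvPolynomial (Fin 2) ℂ) (J : Finset (Fin m)) (j₀ : Fin m) (hj₀ : j₀ ∈ J) :
    ∏ j, (1 + merge u J j₀ j) = ∏ j, (1 + u j) := by
  classical
  rw [← Finset.prod_mul_prod_compl J (fun j => 1 + merge u J j₀ j),
    ← Finset.prod_mul_prod_compl J (fun j => 1 + u j)]
  congr 1
  · rw [← Finset.mul_prod_erase J (fun j => 1 + merge u J j₀ j) hj₀]
    rw [Finset.prod_eq_one (s := J.erase j₀) (f := fun j => 1 + merge u J j₀ j) ?_]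
    · rw [merge_self]; ring
    · intro j hj
      rw [merge_of_mem u J j₀ (Finset.mem_of_mem_erase hj) (Finset.ne_of_mem_erase hj)]
      simp
  · refine Finset.prod_congr rfl fun j hj => ?_
    rw [merge_of_not_mem u J j₀ (Finset.mem_compl.1 hj) hj₀]

/-- Merging does not change `tailDiff u v = ∏(1+u_j) − ∏(1+v_j)`. [folklore] -/
theorem tailDiff_merge (u v : Fin m → MvPolynomial (Fin 2) ℂ) (J : Finset (Fin m)) (j₀ : Fin m) (hj₀ : j₀ ∈ J) :
    tailDiff (merge u J j₀) (merge v J j₀) = tailDiff u v := by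
  simp only [tailDiff, prod_one_add_merge u J j₀ hj₀, prod_one_add_merge v J j₀ hj₀]

/-- Merging preserves «no constant term». [folklore] -/
theorem coeff_zero_merge (u : Fin m → MvPolynomial (Fin 2) ℂ) (J : Finset (Fin m)) (j₀ : Fin m)
    (hu0 : ∀ j, coeff 0 (u j) = 0) (j : Fin m) : coeff 0 (merge u J j₀ j) = 0 := by
  classical
  unfold merge
  split_ifs with h1 h2
  · have h : ∀ i, constantCoeff (u i) = 0 := fun i => by rw [constantCoeff_eq]; exact hu0 i
    have key : constantCoeff ((∏ i ∈ J, (1 + u i)) - 1) = 0 := by simp [map_prod, h]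
    simpa [constantCoeff_eq] using key
  · simp
  · exact hu0 j

/-- Support of `∏_{i∈J}(1+u_i)`: every exponent is a sum over `J` of letters `g_i ∈ supp u_i ∪ {0}`. -/
theorem support_prod_one_add (u : Fin m → MvPolynomial (Fin 2) ℂ) (J : Finset (Fin m)) :
    ∀ e ∈ (∏ i ∈ J, (1 + u i)).support, ∃ g : Fin m → Expo,
      (∀ i, g i ∈ insert (0 : Expo) (u i).support) ∧ (∀ i, i ∉ J → g i = 0) ∧ ∑ i ∈ J, g i = e := by
  classical
  induction J using Finset.induction_on with
  | empty =>
    intro e he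
    simp only [Finset.prod_empty] at he
    have h0 : e = 0 := by
      have h1 : e ∈ ({0} : Finset Expo) := by
        have := MvPolynomial.support_one (R := ℂ) (σ := Fin 2)
        rw [this] at he; exact he
      simpa using h1
    exact ⟨fun _ => 0, fun i => by simp, fun i _ => rfl, by simp [h0]⟩
  | @insert a J haJ ih =>
    intro e he
    rw [Finset.prod_insert haJ] at he
    obtain ⟨x, hx, y, hy, hxy⟩ := Finset.mem_add.1 (MvPolynomial.support_mul _ _ he)
    obtain ⟨g, hg0, hgJ, hgsum⟩ := ih y hy
    have hx' : x ∈ insert (0 : Expo) (u a).support := by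
      rcases Finset.mem_union.1 (MvPolynomial.support_add hx) with h | h
      · rw [MvPolynomial.support_one] at h
        simp [Finset.mem_singleton.1 h]
      · exact Finset.mem_insert_of_mem h
    refine ⟨Function.update g a x, ?_, ?_, ?_⟩
    · intro i
      by_cases hi : i = a
      · subst hi; simpa using hx'
      · simpa [Function.update_apply, hi] using hg0 i
    · intro i hi
      have hia : i ≠ a := fun h => hi (h ▸ Finset.mem_insert_self a J)
      have hiJ : i ∉ J := fun h => hi (Finset.mem_insert_of_mem h)
      simp [hia, hgJ i hiJ]
    · rw [Finset.sum_insert haJ]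
      have h1 : Function.update g a x a = x := by simp
      have h2 : ∑ i ∈ J, Function.update g a x i = ∑ i ∈ J, g i :=
        Finset.sum_congr rfl fun i hi => by
          have : i ≠ a := fun h => haJ (h ▸ hi)
          simp [this]
      rw [h1, h2, hgsum, hxy]

/-- Nonzero support points of the merged block are block sums, and valid weights stay valid. -/
theorem mem_support_merge_self (u : Fin m → MvPolynomial (Fin 2) ℂ) (J : Finset (Fin m)) (j₀ : Fin m)
    (hu0 : ∀ j, coeff 0 (u j) = 0) {e : Expo} (he : e ∈ (merge u J j₀ j₀).support) :
    e ≠ 0 ∧ e ∈ (∏ i ∈ J, (1 + u i)).support := by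
  classical
  have hne : e ≠ 0 := by
    rintro rfl
    exact (MvPolynomial.mem_support_iff.1 he) (coeff_zero_merge u J j₀ hu0 j₀)
  refine ⟨hne, ?_⟩
  rw [merge_self] at he
  rcases Finset.mem_union.1 (MvPolynomial.support_sub _ _ _ he) with h | h
  · exact h
  · rw [MvPolynomial.support_one] at h
    exact absurd (Finset.mem_singleton.1 h) hne

/-- A weight that is negative on every tail letter stays negative on every letter of the merged tails. [folklore] -/
theorem wt_neg_of_mem_support_merge (w : Fin m → MvPolynomial (Fin 2) ℂ) (J : Finset (Fin m)) (j₀ : Fin m)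
    (hw0 : ∀ j, coeff 0 (w j) = 0) (ξ : Fin 2 → ℝ) (hξ : ∀ j, ∀ e ∈ (w j).support, wt ξ e < 0) (hj₀ : j₀ ∈ J)
    (j : Fin m) : ∀ e ∈ (merge w J j₀ j).support, wt ξ e < 0 := by
  classical
  intro e he
  by_cases h1 : j = j₀
  · subst h1
    obtain ⟨hne, he'⟩ := mem_support_merge_self w J j hw0 he
    obtain ⟨g, hg0, hgJ, hge⟩ := support_prod_one_add w J e he'
    have hle : ∀ i, wt ξ (g i) ≤ 0 := fun i => by
      rcases Finset.mem_insert.1 (hg0 i) with h | h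
      · simp [h, wt]
      · exact (hξ i _ h).le
    obtain ⟨i₁, hi₁J, hi₁⟩ : ∃ i ∈ J, g i ≠ 0 := by
      by_contra hcon
      simp only [ne_eq, not_exists, not_and, not_not] at hcon
      exact hne (by rw [← hge]; exact Finset.sum_eq_zero hcon)
    have hlt : wt ξ (g i₁) < 0 := by
      rcases Finset.mem_insert.1 (hg0 i₁) with h | h
      · exact absurd h hi₁
      · exact hξ i₁ _ h
    rw [← hge, wt_sum, ← Finset.add_sum_erase J _ hi₁J]
    have : ∑ x ∈ J.erase i₁, wt ξ (g x) ≤ 0 := Finset.sum_nonpos fun i _ => hle i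
    linarith
  · by_cases h2 : j ∈ J
    · rw [merge_of_mem w J j₀ h2 h1] at he
      simp at he
    · rw [merge_of_not_mem w J j₀ h2 hj₀] at he
      exact hξ j e he

/-- Valid weights for `(u, v)` are valid for the merged pair. [folklore] -/
theorem validWeight_merge (u v : Fin m → MvPolynomial (Fin 2) ℂ) (J : Finset (Fin m)) (j₀ : Fin m) (hj₀ : j₀ ∈ J)
    (hu0 : ∀ j, coeff 0 (u j) = 0) (hv0 : ∀ j, coeff 0 (v j) = 0) {ξ : Fin 2 → ℝ} (hξ : ValidWeight u v ξ) :
    ValidWeight (merge u J j₀) (merge v J j₀) ξ :=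
  ⟨wt_neg_of_mem_support_merge u J j₀ hu0 ξ hξ.1 hj₀, wt_neg_of_mem_support_merge v J j₀ hv0 ξ hξ.2 hj₀⟩

/-- The block sumset `Σ_{j∈J}` of the letter tuples. -/
def blockSet (A : Fin m → Finset Expo) (J : Finset (Fin m)) : Finset Expo :=
  (tuples A).image fun a => ∑ j ∈ J, a j

/-- The merged letter family. -/
def mergeA (A : Fin m → Finset Expo) (J : Finset (Fin m)) (j₀ : Fin m) : Fin m → Finset Expo :=
  fun j => if j = j₀ then (blockSet A J).erase 0 else if j ∈ J then ∅ else A j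

/-- `0` is not a letter of the merged letter family `mergeA`. [folklore] -/
theorem zero_not_mem_mergeA (A : Fin m → Finset Expo) (J : Finset (Fin m)) (j₀ : Fin m)
    (hA0 : ∀ j, (0 : Expo) ∉ A j) (j : Fin m) : (0 : Expo) ∉ mergeA A J j₀ j := by
  classical
  unfold mergeA
  split_ifs with h1 h2
  · simp
  · simp
  · exact hA0 j

/-- The merged tails are supported on the merged letter family: `supp (merge u J j₀ j) ⊆ mergeA A J j₀ j`. [folklore] -/
theorem support_merge_subset (u : Fin m → MvPolynomial (Fin 2) ℂ) (A : Fin m → Finset Expo) (J : Finset (Fin m))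
    (j₀ : Fin m) (hj₀ : j₀ ∈ J) (hA0 : ∀ j, (0 : Expo) ∉ A j) (hu : ∀ j, (u j).support ⊆ A j) (j : Fin m) :
    (merge u J j₀ j).support ⊆ mergeA A J j₀ j := by
  classical
  have hu0 : ∀ j, coeff 0 (u j) = 0 := fun j => notMem_support_iff.1 fun h => hA0 j (hu j h)
  intro e he
  unfold mergeA
  by_cases h1 : j = j₀
  · subst h1
    rw [if_pos rfl]
    obtain ⟨hne, he'⟩ := mem_support_merge_self u J j hu0 he
    obtain ⟨g, hg0, hgJ, hge⟩ := support_prod_one_add u J e he'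
    refine Finset.mem_erase.2 ⟨hne, Finset.mem_image.2 ⟨g, ?_, hge⟩⟩
    refine Fintype.mem_piFinset.2 fun i => ?_
    rcases Finset.mem_insert.1 (hg0 i) with h | h
    · rw [h]; exact Finset.mem_insert_self _ _
    · exact Finset.mem_insert_of_mem (hu i h)
  · rw [if_neg h1]
    by_cases h2 : j ∈ J
    · rw [merge_of_mem u J j₀ h2 h1] at he
      simp at he
    · rw [if_neg h2]
      rw [merge_of_not_mem u J j₀ h2 hj₀] at he
      exact hu j he

/-- CONFINEMENT ⇒ the merged letter family is DISSOCIATED. -/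
theorem injOn_mergeA (A : Fin m → Finset Expo) (J : Finset (Fin m)) (j₀ : Fin m) (hj₀ : j₀ ∈ J)
    (hconf : Confined A J) :
    Set.InjOn (fun a : Fin m → Expo => ∑ j, a j) ↑(Fintype.piFinset fun j => insert 0 (mergeA A J j₀ j)) := by
  classical
  -- every merged tuple lifts to an original tuple with the same total and the same entries off `J`
  have lift : ∀ a' ∈ (Fintype.piFinset fun j => insert (0 : Expo) (mergeA A J j₀ j)),
      (∀ j ∈ J, j ≠ j₀ → a' j = 0) ∧
      ∃ a ∈ tuples A, (∀ j, j ∉ J → a j = a' j) ∧ ∑ j, a j = ∑ j, a' j := by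
    intro a' ha'
    have hmem := Fintype.mem_piFinset.1 ha'
    have hzero : ∀ j ∈ J, j ≠ j₀ → a' j = 0 := by
      intro j hj hne
      have := hmem j
      simp only [mergeA, if_neg hne, if_pos hj] at this
      simpa using this
    refine ⟨hzero, ?_⟩
    -- the block entry is a block sum
    have hblk : ∃ a ∈ tuples A, ∑ j ∈ J, a j = a' j₀ := by
      have := hmem j₀
      simp only [mergeA] at this
      rcases Finset.mem_insert.1 this with h | h
      · refine ⟨fun _ => 0, ?_, by simp [h]⟩
        exact Fintype.mem_piFinset.2 fun j => Finset.mem_insert_self _ _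
      · obtain ⟨a, ha, hsum⟩ := Finset.mem_image.1 (Finset.mem_of_mem_erase h)
        exact ⟨a, ha, hsum⟩
    obtain ⟨a, ha, hsum⟩ := hblk
    refine ⟨fun j => if j ∈ J then a j else a' j, ?_, ?_, ?_⟩
    · refine Fintype.mem_piFinset.2 fun j => ?_
      by_cases hj : j ∈ J
      · simpa [hj] using Fintype.mem_piFinset.1 ha j
      · have hne : j ≠ j₀ := fun h => hj (h ▸ hj₀)
        have := hmem j
        simp only [mergeA, if_neg hne, if_neg hj] at this
        simpa [hj] using this
    · intro j hj; simp [hj]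
    · rw [← Finset.sum_add_sum_compl J (fun j => if j ∈ J then a j else a' j), ← Finset.sum_add_sum_compl J a']
      have e1 : ∑ j ∈ J, (if j ∈ J then a j else a' j) = ∑ j ∈ J, a j :=
        Finset.sum_congr rfl fun j hj => by simp [hj]
      have e2 : ∑ j ∈ Jᶜ, (if j ∈ J then a j else a' j) = ∑ j ∈ Jᶜ, a' j :=
        Finset.sum_congr rfl fun j hj => by simp [Finset.mem_compl.1 hj]
      have e3 : ∑ j ∈ J, a' j = a' j₀ := by
        rw [← Finset.add_sum_erase J a' hj₀,
          Finset.sum_eq_zero (fun j hj => hzero j (Finset.mem_of_mem_erase hj) (Finset.ne_of_mem_erase hj)),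
          add_zero]
      rw [e1, e2, e3, hsum]
  intro a' ha' b' hb' hab
  obtain ⟨hza, a, ha, haJ, hasum⟩ := lift a' ha'
  obtain ⟨hzb, b, hb, hbJ, hbsum⟩ := lift b' hb'
  have hab0 : ∑ j, a' j = ∑ j, b' j := hab
  have hab' : ∑ j, a j = ∑ j, b j := by rw [hasum, hbsum]; exact hab0
  have hoff : ∀ j, j ∉ J → a' j = b' j := fun j hj => by
    rw [← haJ j hj, ← hbJ j hj]; exact hconf a ha b hb hab' j hj
  have hne : ∀ j, j ≠ j₀ → a' j = b' j := by
    intro j hj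
    by_cases hJ : j ∈ J
    · rw [hza j hJ hj, hzb j hJ hj]
    · exact hoff j hJ
  funext j
  by_cases hj : j = j₀
  · subst hj
    have ea := Finset.add_sum_erase Finset.univ a' (Finset.mem_univ j)
    have eb := Finset.add_sum_erase Finset.univ b' (Finset.mem_univ j)
    have es : ∑ x ∈ Finset.univ.erase j, a' x = ∑ x ∈ Finset.univ.erase j, b' x :=
      Finset.sum_congr rfl fun x hx => hne x (Finset.ne_of_mem_erase hx)
    have key : a' j + ∑ x ∈ Finset.univ.erase j, a' x = b' j + ∑ x ∈ Finset.univ.erase j, a' x := by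
      rw [ea, es, eb]; exact hab0
    exact add_right_cancel key
  · exact hne j hj

/-- (local copy, κ = 0) `Confined A ∅` ⇒ linear bound, p603804 by name. -/
theorem confinedLaw_rung_zero' (u v : Fin m → MvPolynomial (Fin 2) ℂ) (A : Fin m → Finset Expo)
    (hA0 : ∀ j, (0 : Expo) ∉ A j) (hu : ∀ j, (u j).support ⊆ A j) (hv : ∀ j, (v j).support ⊆ A j)
    (hconf : Confined A ∅) (R : Expo → Expo → Prop) (S : Finset Expo) (hS : IsCellFamily u v R S) :
    S.card ≤ 2 * m + 2 := by
  refine planarCell_dissociated_linear u v A hA0 hu hv ?_ R S hS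
  intro a ha b hb hab
  funext j
  exact hconf a (Finset.mem_coe.1 ha) b (Finset.mem_coe.1 hb) hab j (by simp)

/-- The merged tail support has at most `M + m s` letters. -/
theorem card_tailSupport_merge_le (u v : Fin m → MvPolynomial (Fin 2) ℂ) (A : Fin m → Finset Expo)
    (J : Finset (Fin m)) (j₀ : Fin m) (hj₀ : j₀ ∈ J) (hA0 : ∀ j, (0 : Expo) ∉ A j)
    (hu : ∀ j, (u j).support ⊆ A j) (hv : ∀ j, (v j).support ⊆ A j) (M s : ℕ) (hAs : ∀ j, (A j).card ≤ s)
    (hB : BlockSmall A J M) :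
    (tailSupport (merge u J j₀) (merge v J j₀)).card ≤ M + m * s := by
  classical
  have hsub : tailSupport (merge u J j₀) (merge v J j₀) ⊆ Finset.univ.biUnion (mergeA A J j₀) := by
    intro e he
    unfold tailSupport at he
    rcases Finset.mem_union.1 he with h | h
    · obtain ⟨j, -, hj⟩ := Finset.mem_biUnion.1 h
      exact Finset.mem_biUnion.2 ⟨j, Finset.mem_univ _, support_merge_subset u A J j₀ hj₀ hA0 hu j hj⟩
    · obtain ⟨j, -, hj⟩ := Finset.mem_biUnion.1 h
      exact Finset.mem_biUnion.2 ⟨j, Finset.mem_univ _, support_merge_subset v A J j₀ hj₀ hA0 hv j hj⟩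
  have hcardA : ∀ j, (mergeA A J j₀ j).card ≤ (if j = j₀ then M else 0) + (A j).card := by
    intro j
    unfold mergeA
    split_ifs with h1 h2
    · obtain ⟨P, hP, hPmem⟩ := hB
      calc ((blockSet A J).erase 0).card ≤ (blockSet A J).card := Finset.card_erase_le
        _ ≤ P.card := Finset.card_le_card (fun e he => by
            obtain ⟨a, ha, hae⟩ := Finset.mem_image.1 he
            rw [← hae]; exact hPmem a ha)
        _ ≤ M + (A j).card := by omega
    · simp
    · simp
  have hsumA : ∑ j, (A j).card ≤ m * s := by
    have h := Finset.sum_le_sum fun j (_ : j ∈ (Finset.univ : Finset (Fin m))) => hAs j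
    simp only [Finset.sum_const, Finset.card_univ, Fintype.card_fin, smul_eq_mul] at h
    exact h
  calc (tailSupport (merge u J j₀) (merge v J j₀)).card ≤ (Finset.univ.biUnion (mergeA A J j₀)).card :=
        Finset.card_le_card hsub
    _ ≤ ∑ j, (mergeA A J j₀ j).card := Finset.card_biUnion_le
    _ ≤ ∑ j, ((if j = j₀ then M else 0) + (A j).card) := Finset.sum_le_sum fun j _ => hcardA j
    _ = M + ∑ j, (A j).card := by rw [Finset.sum_add_distrib]; simp
    _ ≤ M + m * s := by omega

/-- Final arithmetic of the block law. -/
theorem blockLaw_arith (m s M T c : ℕ) (hT : T ≤ M + m * s) (hc : c ≤ 9 * ((T * T + 1) * 2) * (2 * m + 2)) :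
    c ≤ 2 ^ (3 * m) * (M + s + 2) ^ 9 := by
  set X := M + s + 2 with hX
  have hX2 : 2 ≤ X := by omega
  have hT' : T ≤ (m + 1) * X := by nlinarith
  have hm : m < 2 ^ m := Nat.lt_two_pow_self
  have hm' : m + 1 ≤ 2 ^ m := hm
  have h3 : (m + 1) ^ 3 ≤ 2 ^ (3 * m) := by
    calc (m + 1) ^ 3 ≤ (2 ^ m) ^ 3 := Nat.pow_le_pow_left hm' 3
      _ = 2 ^ (3 * m) := by rw [← pow_mul, mul_comm]
  have hX7 : 72 ≤ X ^ 7 := le_trans (by norm_num : 72 ≤ 2 ^ 7) (Nat.pow_le_pow_left hX2 7)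
  have h1 : c ≤ 36 * (m + 1) * (T * T + 1) := by nlinarith [hc]
  have hY : 2 ≤ (m + 1) * X := le_trans hX2 (Nat.le_mul_of_pos_left X (Nat.succ_pos m))
  have hTT : T * T ≤ ((m + 1) * X) * ((m + 1) * X) := Nat.mul_le_mul hT' hT'
  have h2 : T * T + 1 ≤ 2 * ((m + 1) * X) ^ 2 := by nlinarith [hTT, hY]
  have h4 : c ≤ 72 * (m + 1) ^ 3 * X ^ 2 := by
    calc c ≤ 36 * (m + 1) * (T * T + 1) := h1
      _ ≤ 36 * (m + 1) * (2 * ((m + 1) * X) ^ 2) := Nat.mul_le_mul_left _ h2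
      _ = 72 * (m + 1) ^ 3 * X ^ 2 := by ring
  calc c ≤ 72 * (m + 1) ^ 3 * X ^ 2 := h4
    _ ≤ X ^ 7 * 2 ^ (3 * m) * X ^ 2 := Nat.mul_le_mul (Nat.mul_le_mul hX7 h3) le_rfl
    _ = 2 ^ (3 * m) * X ^ 9 := by ring

end BlockMerge

end Summit.ValiantsHypothesis.ValiantsHypothesis.Theorems.NewtonUnitEquations.TwoProducts.PlanarCell

end
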